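import Summits.CriticalPhenomena.PercolationContinuityZ3.Theorems.PercNearOneGluingNoHeavyPcintBondCertZ3K6Defs
import HarnessLib

/-!
# PCINT lane, kernel check 6/8 of the B3r window certificate (`d = 3`, memory 6, `p = 0.2176`): codes `4860 ≤ n < 5832`

Cell `prim-pcint`, seat `prim-pcint-2`. The Collatz–Wielandt rows `10^5 · rowB ≤ 99995 · 2·10^72 · v` for the windows with
base-6 code in `[4860, 5832)`, by `decide +kernel` (natural-number arithmetic only; four chunks of 243 codes — larger
chunks exceed the kernel's recursion budget for these rows — hence `maxHeartbeats 0`). Does NOT build on p205010.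
-/

namespace Summit.CriticalPhenomena.PercolationContinuityZ3.Theorems.Pcint.Z3B6

set_option maxHeartbeats 0 in
/-- Rows `4860 ≤ n < 5103` of the certificate hold. [folklore] -/
theorem checkRangeB_6a : checkRangeB 4860 5103 = true := by decide +kernel

set_option maxHeartbeats 0 in
/-- Rows `5103 ≤ n < 5346` of the certificate hold. [folklore] -/
theorem checkRangeB_6b : checkRangeB 5103 5346 = true := by decide +kernel

set_option maxHeartbeats 0 in
/-- Rows `5346 ≤ n < 5589` of the certificate hold. [folklore] -/
theorem checkRangeB_6c : checkRangeB 5346 5589 = true := by decide +kernel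

set_option maxHeartbeats 0 in
/-- Rows `5589 ≤ n < 5832` of the certificate hold. [folklore] -/
theorem checkRangeB_6d : checkRangeB 5589 5832 = true := by decide +kernel

/-- Rows `4860 ≤ n < 5832` of the certificate hold. [folklore] -/
theorem checkRangeB_6 : checkRangeB 4860 5832 = true :=
  checkRangeB_of_split (checkRangeB_of_split checkRangeB_6a checkRangeB_6b) (checkRangeB_of_split checkRangeB_6c checkRangeB_6d)

end Summit.CriticalPhenomena.PercolationContinuityZ3.Theorems.Pcint.Z3B6
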